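import Summits.ResolutionOfSingularities.ResolutionOfSingularities.Theorems.FrobeniusLadderFInjectiveMacaulayficationFanCheckSoundBinders
import Summits.ResolutionOfSingularities.ResolutionOfSingularities.Theorems.FrobeniusLadderFInjectiveMacaulayficationT4Char7FanHeavyTables
import Summits.ResolutionOfSingularities.ResolutionOfSingularities.Theorems.FrobeniusLadderFInjectiveMacaulayficationT4Char7Fan
import Mathlib.Tactic.Ring
import HarnessLib

/-!
# `T⁽⁴⁾/7` road B: the HEAVY fan binders `hV`, `hgen`, `hge` for all `537` charts, over stub-3's names
# (crux `FInjectiveMacaulayfication`, `T4Char7FanHeavy`, SEAT TABLE v16 / R12.54 (7) / R12.61 (2))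

[OURS · L1 W4.5a] Support file for crux stmt-ResolutionOfSingularities-15315 (seat res-L1-w45a-stub-4). The three chart-indexed fan
hypotheses of `PointFixableOfCert.pointFixable_of_ciCert` for the deciding specimen `T⁽⁴⁾` at `p = 7` (res-L1-w45a-tri-1's toric
certificate, 537 unimodular charts, 1926 centre generators) — unimodularity `hV`, the neighbour identities (hgen), and the vertex
property (hge) = `537 × 1926` vector inequalities — stated over stub-3's tables `T4Char7Fan.{V, A, m, a}` (the names stub-1's instance
`T4OriginPointFixableChar7` and stub-5's `T4Char7Poly` use), and proved by:

* §0 generic two-level/flat indexing (`get2_eq_getL_flatten`);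
* §1 FIVE kernel checks of `FanCheckKit` on the two-level tables `T4Char7FanHeavyTables.{AL2, RAYS, CL, VinvTL}` (`checkShapes`,
  `checkHgen`, `checkHge` — ray by ray, `max ≤ min` —, `checkDetUnit`), each ONE `decide +kernel`;
* §2 BRIDGES, each ONE `decide +kernel` over stub-3's flat tables, read once per chart (R12.61 (2) TABLE-DEPTH RULE):
  `T4Char7Fan.AL = AL2.flatten.map (vecOf 5)` (hence `T4Char7Fan.A = genSet 5 AL2`), `T4Char7Fan.V c = chartV …`, `T4Char7Fan.m c = chartM …`,
  `T4Char7Fan.a c i = chartA …` (the last through the flat neighbour INDEX `aIdx c i = 44·chunk + position`, not through 2685 deep lookups);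
* §3 the exports `hV`, `hgen`, `hge` by `FanCheckSound.{hV_of_check, hgen_of_check, hge_of_check}` and the bridges.

MEASURED: the whole module elaborates in ≈ 150 s on the farm, default heartbeats (hge check ≈ 75 s, bridges ≈ 40 s).
No definitions, no named facts; AI-written, weaker than expert review; no statement of [claim: Hironaka2017] is used. [folklore]
-/

-- single-problem summit: the doubled namespace component is forced
set_option linter.dupNamespace false

namespace Summit.ResolutionOfSingularities.ResolutionOfSingularities.Theorems.FInjectiveMacaulayfication.T4Char7FanHeavy

open Summit.ResolutionOfSingularities.ResolutionOfSingularities.Theorems.FInjectiveMacaulayfication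
open FanCheckKit FanCheckSound T4Char7FanHeavyTables

/-! ## §0 Two-level versus flat indexing (generic) -/

/-- `getL` on an append, left part. [folklore] -/
theorem getL_append_left {α : Type} : ∀ (l₁ l₂ : List α) (i : ℕ) (d : α), i < l₁.length → getL (l₁ ++ l₂) i d = getL l₁ i d
  | [], _, _, _, h => absurd h (by simp)
  | _ :: _, _, 0, _, _ => rfl
  | _ :: as, l₂, i + 1, d, h => by
    rw [List.cons_append, getL_cons_succ, getL_cons_succ]
    exact getL_append_left as l₂ i d (by simpa using h)

/-- `getL` on an append, right part. [folklore] -/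
theorem getL_append_right {α : Type} : ∀ (l₁ l₂ : List α) (i : ℕ) (d : α), getL (l₁ ++ l₂) (l₁.length + i) d = getL l₂ i d
  | [], _, _, _ => by rw [List.nil_append, List.length_nil, Nat.zero_add]
  | _ :: as, l₂, i, d => by
    rw [List.cons_append, List.length_cons, Nat.add_right_comm, getL_cons_succ]
    exact getL_append_right as l₂ i d

/-- **Two-level versus flat**: with all chunks before chunk `ci` of length `s`, the generator `(ci, pi)` is entry `s·ci + pi` of the
flattened list. [folklore] -/
theorem get2_eq_getL_flatten (s : ℕ) : ∀ (AL2 : List (List (List ℕ))) (ci pi : ℕ),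
    (∀ k < ci, (getL AL2 k []).length = s) → pi < (getL AL2 ci []).length → get2 AL2 (ci, pi) = getL AL2.flatten (s * ci + pi) []
  | [], ci, pi, _, h => absurd h (by rw [getL_nil]; exact Nat.not_lt_zero _)
  | ch :: rest, 0, pi, _, h => by
    rw [Nat.mul_zero, Nat.zero_add, List.flatten_cons, getL_append_left _ _ _ _ (by rwa [getL_cons_zero] at h)]
    rfl
  | ch :: rest, ci + 1, pi, hk, h => by
    have hch : ch.length = s := by have := hk 0 (Nat.succ_pos _); rwa [getL_cons_zero] at this
    rw [List.flatten_cons, show s * (ci + 1) + pi = ch.length + (s * ci + pi) by rw [hch]; ring, getL_append_right,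
      ← get2_eq_getL_flatten s rest ci pi (fun k hk' => by have := hk (k + 1) (by omega); rwa [getL_cons_succ] at this)
        (by rwa [getL_cons_succ] at h)]
    rfl

/-- `List.getD` is `getL`. [folklore] -/
theorem getD_eq_getL {α : Type} : ∀ (l : List α) (i : ℕ) (d : α), l.getD i d = getL l i d
  | [], i, d => by rw [List.getD_nil, getL_nil]
  | a :: as, 0, d => by rw [List.getD_cons_zero, getL_cons_zero]
  | a :: as, i + 1, d => by rw [List.getD_cons_succ, getL_cons_succ]; exact getD_eq_getL as i d

/-- The zero vector is `vecOf n []`. [folklore] -/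
theorem vecOf_nil (n : ℕ) : vecOf n [] = 0 := by
  funext i
  exact getL_nil _ _

/-! ## §1 The kernel checks on the two-level tables -/

/-- Shapes and index bounds of the local tables. [folklore] -/
theorem shapes : checkShapes 5 1 AL2 RAYS CL = true := by decide +kernel

/-- `537` charts. [folklore] -/
theorem tlen : CL.length = 537 := by decide +kernel

/-- (hgen) check. [folklore] -/
theorem check_hgen : checkHgen 5 AL2 RAYS CL = true := by decide +kernel

/-- (hge) check — the vertex property, ray by ray (≈ 75 s of kernel time). [folklore] -/
theorem check_hge : checkHge AL2 RAYS CL = true := by decide +kernel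

/-- (hV) check: `V c · Vinv c = 1` over `ℤ` for all `c`. [folklore] -/
theorem check_det : checkDetUnit 5 RAYS CL VinvTL = true := by decide +kernel

/-! ## §2 Bridges: stub-3's flat tables `T4Char7Fan.{AL, V, mF, aF}` agree with the two-level tables (one `decide` each) -/

/-- Bridge check for the generator list. [folklore] -/
theorem bridgeAL_check : (Nat.beq T4Char7Fan.AL.length AL2.flatten.length &&
    (T4Char7Fan.AL.zip AL2.flatten).all fun p => (List.finRange 5).all fun j => Nat.beq (p.1 j) (getL p.2 j.1 0)) = true := by
  decide +kernel

/-- **Bridge `AL`**: stub-3's generator list is the flattened two-level list read through `vecOf`. [folklore] -/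
theorem bridgeAL : T4Char7Fan.AL = AL2.flatten.map (vecOf 5) := by
  have h := bridgeAL_check
  simp only [Bool.and_eq_true, Nat.beq_eq, List.all_eq_true] at h
  obtain ⟨hlen, hall⟩ := h
  apply List.ext_getElem
  · rw [List.length_map, hlen]
  · intro k h1 h2
    have hk2 : k < AL2.flatten.length := by rwa [List.length_map] at h2
    rw [List.getElem_map, ← getL_eq_getElem _ _ 0 h1, ← getL_eq_getElem _ _ [] hk2]
    funext j
    exact hall _ (mk_getL_mem_zip T4Char7Fan.AL AL2.flatten 0 [] k h1 hk2) j (List.mem_finRange j)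

/-- **Bridge `A`**: stub-3's centre is `genSet 5 AL2`. [folklore] -/
theorem bridgeA : T4Char7Fan.A = genSet 5 AL2 := by
  rw [T4Char7Fan.A, bridgeAL, List.map_map]
  rfl

/-- Bridge check for the cone matrices. [folklore] -/
theorem bridgeV_check : ((List.finRange 537).all fun c => (List.finRange 5).all fun i => (List.finRange 5).all fun j =>
    Nat.beq (T4Char7Fan.V c i j) (chartV 5 RAYS CL 537 c i j)) = true := by
  decide +kernel

/-- **Bridge `V`**. [folklore] -/
theorem bridgeV (c : Fin 537) : T4Char7Fan.V c = chartV 5 RAYS CL 537 c := by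
  have h := bridgeV_check
  simp only [List.all_eq_true, Nat.beq_eq] at h
  ext i j
  exact h c (List.mem_finRange c) i (List.mem_finRange i) j (List.mem_finRange j)

/-- Bridge check for the vertices. [folklore] -/
theorem bridgeM_check : ((List.finRange 537).all fun c => (List.finRange 5).all fun j =>
    Nat.beq (T4Char7Fan.mF c j) (vecOf 5 (get2 AL2 (chartRec CL c.1).2.1) j)) = true := by
  decide +kernel

/-- **Bridge `m`**. [folklore] -/
theorem bridgeM (c : Fin 537) : T4Char7Fan.m c = chartM 5 AL2 CL 537 c := by
  have h := bridgeM_check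
  simp only [List.all_eq_true, Nat.beq_eq] at h
  show Finsupp.equivFunOnFinite.symm (T4Char7Fan.mF c) = Finsupp.equivFunOnFinite.symm (vecOf 5 (get2 AL2 (chartRec CL c.1).2.1))
  congr 1
  funext j
  exact h c (List.mem_finRange c) j (List.mem_finRange j)

/-- All generator chunks but the last have length `44`. [folklore] -/
theorem chunks_check : ((List.range 43).all fun k => Nat.beq (getL AL2 k []).length 44) = true := by decide +kernel

/-- Index bridge check for the neighbours: stub-3's flat index `aIdx c i` is `44 · chunk + position` of the local index pair, which is
in range. [folklore] -/
theorem bridgeAIdx_check : ((List.finRange 537).all fun c => (List.finRange 5).all fun i =>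
    Nat.beq (T4Char7Fan.aIdx c i).val
        (44 * (getL (chartRec CL c.1).2.2.1 i.1 (0, 0)).1 + (getL (chartRec CL c.1).2.2.1 i.1 (0, 0)).2) &&
      Nat.ble (getL (chartRec CL c.1).2.2.1 i.1 (0, 0)).1 43 &&
      Nat.blt (getL (chartRec CL c.1).2.2.1 i.1 (0, 0)).2 (getL AL2 (getL (chartRec CL c.1).2.2.1 i.1 (0, 0)).1 []).length) =
    true := by
  decide +kernel

/-- **Bridge `a`** (through `bridgeAL` and the two-level/flat index identity). [folklore] -/
theorem bridgeAvec (c : Fin 537) (i : Fin 5) : T4Char7Fan.a c i = chartA 5 AL2 CL 537 c i := by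
  have hu := chunks_check
  simp only [List.all_eq_true, List.mem_range, Nat.beq_eq] at hu
  have h := bridgeAIdx_check
  simp only [List.all_eq_true, Bool.and_eq_true, Nat.beq_eq, Nat.ble_eq, Nat.blt_eq] at h
  obtain ⟨⟨hk, hci⟩, hpi⟩ := h c (List.mem_finRange c) i (List.mem_finRange i)
  show Finsupp.equivFunOnFinite.symm (T4Char7Fan.AL.getD (T4Char7Fan.aIdx c i).val 0) =
    Finsupp.equivFunOnFinite.symm (vecOf 5 (get2 AL2 (getL (chartRec CL c.1).2.2.1 i.1 (0, 0))))
  congr 1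
  rw [bridgeAL, ← vecOf_nil 5, getD_eq_getL, getL_map_of_apply_default (vecOf 5) [] (vecOf 5 []) rfl, hk,
    ← get2_eq_getL_flatten 44 AL2 _ _ (fun k hk' => hu k (by omega)) hpi]

/-! ## §3 The heavy binders over stub-3's names, for stub-1's instance `T4OriginPointFixableChar7` -/

/-- **(hV) for `T⁽⁴⁾/7`**: every cone matrix `T4Char7Fan.V c` is unimodular. [folklore] -/
theorem hV : ∀ c : Fin 537, IsUnit (((T4Char7Fan.V c).map (Nat.cast : ℕ → ℤ)).det) := fun c => by
  rw [bridgeV]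
  exact hV_of_check 5 1 AL2 RAYS CL 537 VinvTL shapes tlen check_det c

/-- **(hgen) for `T⁽⁴⁾/7`**: `V c · a c i = V c · m c + e_i`. [folklore] -/
theorem hgen : ∀ (c : Fin 537) (i : Fin 5),
    (Finsupp.equivFunOnFinite.symm ((T4Char7Fan.V c).mulVec ⇑(T4Char7Fan.a c i)) : Fin 5 →₀ ℕ) =
      Finsupp.equivFunOnFinite.symm ((T4Char7Fan.V c).mulVec ⇑(T4Char7Fan.m c)) + Finsupp.single i 1 := fun c i => by
  rw [bridgeV, bridgeAvec, bridgeM]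
  exact hgen_of_check 5 1 AL2 RAYS CL 537 shapes tlen check_hgen c i

/-- **(hge) for `T⁽⁴⁾/7`** — the vertex property: `V c · m c ≤ V c · e` for every centre generator `e`. [folklore] -/
theorem hge : ∀ (c : Fin 537), ∀ e ∈ T4Char7Fan.A,
    (Finsupp.equivFunOnFinite.symm ((T4Char7Fan.V c).mulVec ⇑(T4Char7Fan.m c)) : Fin 5 →₀ ℕ) ≤
      Finsupp.equivFunOnFinite.symm ((T4Char7Fan.V c).mulVec ⇑e) := fun c e he => by
  rw [bridgeV, bridgeM]
  rw [bridgeA] at he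
  exact hge_of_check 5 1 AL2 RAYS CL 537 shapes tlen check_hge c e he

end Summit.ResolutionOfSingularities.ResolutionOfSingularities.Theorems.FInjectiveMacaulayfication.T4Char7FanHeavy
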